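import Summits.HodgeConjecture.HodgeConjecture.Theorems.F0P2oThetaTypeNotL2                          -- ★ p831648: `nonempty_equiv_of_thetaTypeAtCM`, `exists_linearEquiv_of_comap_comap_equiv`
import Summits.HodgeConjecture.HodgeConjecture.Theorems.F0P2oGR91NOfLetters                          -- ★ `GR91N_of_letters (hN3) (hW) (hU1)` (#76 from N3, K1w, U1)
import Summits.HodgeConjecture.HodgeConjecture.Theorems.F0P2oU1LetterOfTower                         -- ★ p829230: U1 ⟸ N3 + unique sub
import Summits.HodgeConjecture.HodgeConjecture.Theorems.F0P2pPrincipalSeriesUniqueSubCM              -- ★ p832559: unique sub ⟸ N1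
import Summits.HodgeConjecture.HodgeConjecture.Theorems.F0P2pK1wHolds                                -- ★ p833012: K1w hypothesis-free
import Summits.HodgeConjecture.HodgeConjecture.Theorems.F0P3U3PrincipalSeriesJacquetFiltrationHolds  -- ★ p832625: N1 hypothesis-free
import Summits.HodgeConjecture.HodgeConjecture.Theorems.F0P2iGRDWitness                              -- ★ the dictionary pair `(grdMu, grdChi)`
import Summits.HodgeConjecture.HodgeConjecture.Theorems.F0P3bXiLocalPacketUnitaryOfStubs             -- ★ `exists_qsFrame` (the rational frame of `Φ₃`)
import Summits.HodgeConjecture.HodgeConjecture.Theorems.F0P3KeysLabelledPair                         -- ★ p833040: R1 `cmWeylTorusCharPair_ne_cmXiTorusChar`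
import Literature.NumberTheory.Automorphic.U3PrincipalSeriesJacquetFiltrationFullUnfold              -- ★ p831282: N1 as a theorem-world `Iff`
import Literature.NumberTheory.Rogawski1990.SemilocalQuadraticCharExtension                          -- ★ `isQuadraticCharExtension_semilocalComponent_of_baseChange_eq`
import Literature.NumberTheory.Automorphic.UnitaryGroupFormCongrFinSum                               -- ★ `formCongr_one_eq`
import HarnessLib

/-!
# Crux `H413`, T3 «KeysCaseTwo» line — ROAD T: Keys' case-two reducibility AT THE PROGRAMME'S GLOBAL DATA `(μω, ξ)` from the booked letter
# #96 `thetaType_nonsplit_jacquetModule` (no `c`-function): `i_G(χ_ξ,v)` is reducible because the Weil-representation type is a constituent with a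
# SCALAR Jacquet module, while `r_B i_G(χ_ξ)` carries two distinct characters

Cell hodgecm-mathlib (D-0151), FLOOR 0, crux item H413 = stmt-HodgeConjecture-24833; T3 line `Cruxes/H413/Lines/F0_P3_KeysCaseTwoPaydown.lean` (letter N4
★ `Rogawski1990.KeysCaseTwoReducible`, #106) and its Theorems twin ★ `F0P3KeysCaseTwoOfStubs` (`keysCaseTwo_of_stubs (hN4) (hN5)`); desk words F0P3b-plan
(g10) 20:58:32Z (α) ∕ «road T pays at the closer level».  HONEST LABEL: HC_CM is proved only modulo the printed citations until rung 0 closes; this file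
proves N4 ONLY AT THE DATA THE PROGRAMME CONSUMES (`μ = μω_v`, `η₁ = ξ.η_v`, `η₂ = ξ.ψ_v`, ★ `F0P3XiPacketFamilyOfRecordGlue.keysOfKeysCaseTwo`), CONDITIONALLY on
the ONE print letter #96 (N3) [GelbartRogawski1991 §3.2; Kudla1986 Thm. 2.8] taken as the hypothesis `hN3`; the local-universal N4 as typed is NOT claimed
(it would need, in addition, the globalisation of local conjugate-symplectic characters).

THE MATHEMATICS ([GelbartRogawski1991, §5.1 (5.1.1), Lem. 5.1.2, §5.2]; [Rogawski1990, §12.2 (2) p. 174 «`πⁿ(ξ)` … the Weil representation»]).  At a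
non-split `v`, the U′-N letter #76 — DERIVED in the tree from {N3 = `hN3`, K1w ★ p833012, U1 ★ ⟸ N3 + N1 ★ p832625} by ★ `GR91N_of_letters` — gives, for the
dictionary pair `(μ_ξ, χ_f) = (grdMu, grdChi)` ★ and the rational frame of `Φ₃` ★ (`T = 1`, `a = 1`), a constituent `x₀ ∈ JH(i_G(χ_ξ,v))` whose transport is
the local theta type `X_v(μ_ξ, ε, χ_f)`.  By N3 (b) the torus `T` acts on `r_N(X_v)` by the SCALAR `χθ(t)`; transporting along the equivalence of any
representative `r₀` of `x₀` with `X_v ∘ κ_v⁻¹` (★ `nonempty_equiv_of_thetaTypeAtCM`, the K1c «own class» apparatus) the torus acts on `r_N(r₀)` by the same scalar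
(§2, the block of ★ `F0P2oThetaTypeNotL2.thetaType_not_squareIntegrable`, extracted).  Were `i_G(χ_ξ)` irreducible, `r₀ ≅ i_G(χ_ξ)` (★
`IsConstituentOf.nonempty_equiv_of_isIrreducible`), so `T` would act on `r_B i_G(χ_ξ)` by scalars — but ★ N1 gives a line with character `wχ_ξ` and quotient
character `χ_ξ ≠ wχ_ξ` (★ R1), and a two-dimensional module with a stable line and two DISTINCT characters is not scalar (§1).  Hence `i_G(χ_ξ,v)` is reducible.

* §1 `eq_of_line_of_forall_exists_smul` — generic: `dim X = 2`, stable line `ℓ` with character `θ₁`, quotient character `θ₂`, every `τ(m)` a scalar ⇒ `θ₁ = θ₂`;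
  `nonempty_equiv_of_forall_eq_top` — an irreducible-by-hypothesis representation is equivalent to each constituent (★, instance-free form).
* §2 `jacquetModule_eq_smul_of_thetaTypeAtCM` — the torus acts on the Jacquet module of ANY representative of a class which «is the theta type» by the scalar
  `χθ = cmXiTorusChar L v μ_v ψθ⁻¹ ψθ` (under `hN3`; generic in the pair `(μ, χ_f)`, the frame and the form congruence).
* §1b `exists_subrepresentation_of_constituent_jacquet_smul` — generic: Jacquet data (two-dimensional, line `θ₁`, quotient `θ₂ ≠ θ₁`) + a constituent with
  scalar (unnormalised) Jacquet action ⇒ reducible.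
* §3 `cmPrincipalSeries_xi_reducible_of_constituent_jacquet_smul` — `i_G(χ_ξ)` is reducible as soon as some constituent has a representative with scalar
  Jacquet action (N1 ★, R1 ★; hypothesis-free; one generic call).
* §4 **`keysCaseTwoReducibleAt_of_N3 (hN3) (L) (ξ) (μω) (hμu) (hquad) (v) (hv)`** — the N4 text at `(μω_v, ξ.η_v, ξ.ψ_v)`:
  `∃ N : Subrepresentation (i_G(χ_ξ,v)), N ≠ ⊥ ∧ N ≠ ⊤`.

## References
* [GelbartRogawski1991] S. Gelbart, J. Rogawski, Invent. Math. 105 (1991): §3.2 (3.2.1)–(3.2.2) p. 457; §5.1 (5.1.1) p. 465, Lem. 5.1.2 pp. 465–466; §5.2 p. 467.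
* [Kudla1986] S. Kudla, Invent. Math. 83 (1986), Thm. 2.8.  * [Rogawski1990] §12.2 (2) pp. 173–174.  * [Keys1984] §7 Thm. (2) p. 126 (the statement).
* [Casselman1995] L. 7.1.1 (a) p. 67 (the two exponents of `i_G(χ)`).
-/

set_option autoImplicit false
-- the mandated namespace has the single-problem summit's repeated segment (`HodgeConjecture.HodgeConjecture`)
set_option linter.dupNamespace false

noncomputable section

open NumberField IsDedekindDomain MeasureTheory
open scoped Matrix NNReal

open Literature.NumberTheory Literature.NumberTheory.Automorphic Literature.NumberTheory.Automorphic.UnitaryGroup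
open Literature.NumberTheory.Automorphic.IdeleClassGroup
open Literature.NumberTheory.Automorphic.Liu2021 Literature.NumberTheory.Automorphic.Liu2021.Def411WeilCarriers
open Literature.NumberTheory.GaloisRepresentations
open Literature.NumberTheory.Rogawski1990
open Literature.NumberTheory.GelbartRogawski1991
open Literature.RepresentationTheory Literature.RepresentationTheory.FiniteGroups Literature.RepresentationTheory.Semisimple

namespace Summit.HodgeConjecture.HodgeConjecture.Cruxes.H413.F0P3KeysReducibleAtXiDataOfN3

open F0P2oThetaTypeNotL2 F0P2iGRDWitness

/-! ## §1 A two-dimensional module with a stable line and two distinct characters is not scalar -/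

section LinearAlgebra

variable {M : Type*} [Group M] {X : Type*} [AddCommGroup X] [Module ℂ X] (τ : Representation ℂ M X)

/-- **Scalar action forces the two characters to agree.**  If `dim X = 2`, `ℓ ≤ X` is a line on which `M` acts by `θ₁`, `M` acts on `X ⁄ ℓ` by `θ₂`, and
every `τ(m)` is a scalar, then `θ₁ = θ₂`: the scalar is `θ₁(m)` (test on `0 ≠ y ∈ ℓ`), and for `z ∉ ℓ` the vector `(θ₁(m) − θ₂(m)) z = τ(m) z − θ₂(m) z` lies in
`ℓ`, forcing `θ₁(m) = θ₂(m)`.  (Contrapositive of «regular ⇒ not scalar», [Casselman1995, Prop. 6.4.1].) [cite: Casselman1995, Prop. 6.4.1 p. 62; L. 7.1.1 (a) p. 67] -/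
theorem eq_of_line_of_forall_exists_smul [FiniteDimensional ℂ X] (h2 : Module.finrank ℂ X = 2)
    (ℓ : Submodule ℂ X) (hℓ1 : Module.finrank ℂ ↥ℓ = 1) {θ₁ θ₂ : M →* ℂˣ}
    (hℓ : ∀ (m : M), ∀ x ∈ ℓ, τ m x = ((θ₁ m : ℂˣ) : ℂ) • x)
    (hq : ∀ (m : M) (x : X), τ m x - ((θ₂ m : ℂˣ) : ℂ) • x ∈ ℓ)
    (hs : ∀ m : M, ∃ c : ℂ, ∀ x : X, τ m x = c • x) : θ₁ = θ₂ := by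
  -- a non-zero vector in the line and a vector outside it
  have hℓb : ℓ ≠ ⊥ := fun h => by rw [h, finrank_bot] at hℓ1; exact zero_ne_one hℓ1
  obtain ⟨y, hyℓ, hy0⟩ := Submodule.exists_mem_ne_zero_of_ne_bot hℓb
  have hℓt : ℓ ≠ ⊤ := fun h => by rw [h, finrank_top, h2] at hℓ1; exact absurd hℓ1 (by norm_num)
  obtain ⟨z, hzℓ⟩ : ∃ z : X, z ∉ ℓ := by
    by_contra h
    push Not at h
    exact hℓt (Submodule.eq_top_iff'.mpr h)
  refine MonoidHom.ext fun m => Units.ext ?_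
  obtain ⟨c, hc⟩ := hs m
  -- the scalar is `θ₁ m`
  have hc₁ : c = ((θ₁ m : ℂˣ) : ℂ) := by
    have h := (hc y).symm.trans (hℓ m y hyℓ)
    exact smul_left_injective ℂ hy0 h
  -- `(θ₁ m − θ₂ m) • z ∈ ℓ`
  have hmem : (((θ₁ m : ℂˣ) : ℂ) - ((θ₂ m : ℂˣ) : ℂ)) • z ∈ ℓ := by
    rw [sub_smul, ← hc₁, ← hc z]
    exact hq m z
  by_contra hne
  have hd : ((θ₁ m : ℂˣ) : ℂ) - ((θ₂ m : ℂˣ) : ℂ) ≠ 0 := sub_ne_zero.mpr hne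
  exact hzℓ (by simpa [smul_smul, inv_mul_cancel₀ hd] using ℓ.smul_mem (((θ₁ m : ℂˣ) : ℂ) - ((θ₂ m : ℂˣ) : ℂ))⁻¹ hmem)

/-- **An irreducible-by-hypothesis representation is equivalent to each of its constituents** (★ `IsConstituentOf.nonempty_equiv_of_isIrreducible`, with
the irreducibility supplied as «every non-zero `G`-stable subspace is everything» on a non-zero space; stated over an abstract group so that the
instance is found syntactically at the CM carrier). [cite: BushnellHenniart2006, §1.1] -/
theorem nonempty_equiv_of_forall_eq_top {G : Type} [Group G] [TopologicalSpace G] {W : Type} [AddCommGroup W] [Module ℂ W] [Nontrivial W]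
    (ρ : Representation ℂ G W) (r : SmoothIrrep G) (hc : (IrrClass.mk r).IsConstituentOf ρ)
    (h : ∀ N : Subrepresentation ρ, N ≠ ⊥ → N = ⊤) : Nonempty (r.ρ.Equiv ρ) := by
  haveI : Nontrivial (Subrepresentation ρ) := ⟨⟨⊥, ⊤, fun hbt => by
    have h' := congrArg Subrepresentation.toSubmodule hbt
    exact bot_ne_top h'⟩⟩
  haveI : ρ.IsIrreducible := ⟨fun N => (eq_or_ne N ⊥).elim Or.inl fun hb => Or.inr (h N hb)⟩
  exact hc.nonempty_equiv_of_isIrreducible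

end LinearAlgebra

/-! ## §1b The generic reducibility criterion: a constituent with scalar Jacquet action, inside a module with two distinct exponents -/

section Generic

/-- **Scalar (unnormalised) Jacquet action transports along an equivalence and stays scalar after the `δ_P^{-1/2}` twist** (generic; all structure
binders implicit so that consumers unify them from the data). [cite: BernsteinZelevinsky1977, §1.8, §2.3] -/
theorem normalizedJacquet_forall_exists_smul_of_equiv {G : Type} {instG : Group G} {instT : TopologicalSpace G} {instTG : IsTopologicalGroup G}
    {t : ParabolicTriple G} {instLC : LocallyCompactSpace t.P}
    {V : Type} {instV₁ : AddCommGroup V} {instV₂ : Module ℂ V} {ρ : Representation ℂ G V}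
    {W : Type} {instW₁ : AddCommGroup W} {instW₂ : Module ℂ W} {π : Representation ℂ G W}
    (e : π.Equiv ρ) (c : ↥t.M → ℂ)
    (hM : ∀ (m : ↥t.M) (x : (t.restrict π).Coinvariants), π.jacquetModule t m x = c m • x) :
    ∀ m : ↥t.M, ∃ c' : ℂ, ∀ x : (t.restrict ρ).Coinvariants, ρ.normalizedJacquet t m x = c' • x := by
  have hsurj : Function.Surjective (Representation.jacquetMap t e.toIntertwiningMap) := by
    intro y
    obtain ⟨w, rfl⟩ := Representation.Coinvariants.mk_surjective _ y
    exact ⟨Representation.Coinvariants.mk _ (e.symm w), by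
      rw [Representation.jacquetMap_mk]; exact congrArg _ (e.apply_symm_apply w)⟩
  intro m
  -- the unnormalised action on `r(ρ)` is the same scalar
  have hun : ∀ x : (t.restrict ρ).Coinvariants, ρ.jacquetModule t m x = c m • x := fun x => by
    obtain ⟨y, rfl⟩ := hsurj x
    have hJ := Representation.IntertwiningMap.isIntertwining _ _ (Representation.jacquetMap t e.toIntertwiningMap) m y
    rw [← hJ, hM m y, map_smul]
  refine ⟨(((rootDeltaChar t.P (Subgroup.inclusion t.M_le m))⁻¹ : ℂˣ) : ℂ) * c m, fun x => ?_⟩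
  obtain ⟨w, rfl⟩ := Representation.Coinvariants.mk_surjective _ x
  rw [Representation.normalizedJacquet_mk, ← Representation.jacquetModule_mk, hun, smul_smul]

/-- **A constituent with SCALAR Jacquet action inside a representation whose normalised Jacquet module is two-dimensional with a stable line and two
DISTINCT characters forces reducibility** (generic `G`, parabolic triple `t`; structure binders implicit).  Otherwise `ρ` is irreducible, `r₀ ≅ ρ`
(★ `IsConstituentOf.nonempty_equiv_of_isIrreducible`), `r(ρ)` is scalar (`normalizedJacquet_forall_exists_smul_of_equiv`), contradicting §1.
For `U(3)`: `ρ = i_G(χ)`, the Jacquet data = ★ N1, `χ ≠ wχ`. [cite: Casselman1995, L. 7.1.1 (a) p. 67; Prop. 6.4.1 p. 62] [cite: GelbartRogawski1991, §5.2 p. 467] -/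
theorem exists_subrepresentation_of_constituent_jacquet_smul {G : Type} {instG : Group G} {instT : TopologicalSpace G} {instTG : IsTopologicalGroup G}
    {t : ParabolicTriple G} {instLC : LocallyCompactSpace t.P}
    {V : Type} {instV₁ : AddCommGroup V} {instV₂ : Module ℂ V} {ρ : Representation ℂ G V} {θ₁ θ₂ : ↥t.M →* ℂˣ}
    (hfd : FiniteDimensional ℂ (t.restrict ρ).Coinvariants) (h2 : Module.finrank ℂ (t.restrict ρ).Coinvariants = 2)
    (ℓ : Submodule ℂ (t.restrict ρ).Coinvariants) (hℓ1 : Module.finrank ℂ ↥ℓ = 1)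
    (hℓ : ∀ (m : ↥t.M), ∀ x ∈ ℓ, ρ.normalizedJacquet t m x = ((θ₁ m : ℂˣ) : ℂ) • x)
    (hq : ∀ (m : ↥t.M) (x : (t.restrict ρ).Coinvariants), ρ.normalizedJacquet t m x - ((θ₂ m : ℂˣ) : ℂ) • x ∈ ℓ)
    (hne : θ₁ ≠ θ₂) (r₀ : SmoothIrrep G) (hc : (IrrClass.mk r₀).IsConstituentOf ρ) (c : ↥t.M → ℂ)
    (hM : ∀ (m : ↥t.M) (x : (t.restrict r₀.ρ).Coinvariants), r₀.ρ.jacquetModule t m x = c m • x) :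
    ∃ N : Subrepresentation ρ, N ≠ ⊥ ∧ N ≠ ⊤ := by
  haveI := hfd
  by_contra hN
  push Not at hN
  -- `V ≠ 0` since `r(ρ)` is two-dimensional
  haveI : Nontrivial V := by
    by_contra hV
    rw [not_nontrivial_iff_subsingleton] at hV
    haveI : Subsingleton (t.restrict ρ).Coinvariants := (Representation.Coinvariants.mk_surjective _).subsingleton
    have h0 : Module.finrank ℂ (t.restrict ρ).Coinvariants = 0 := Module.finrank_zero_of_subsingleton
    omega
  obtain ⟨e⟩ := nonempty_equiv_of_forall_eq_top ρ r₀ hc hN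
  exact hne (eq_of_line_of_forall_exists_smul _ h2 ℓ hℓ1 hℓ hq (normalizedJacquet_forall_exists_smul_of_equiv e c hM))

end Generic

/-! ## §2 The torus acts on the Jacquet module of a theta-type class by the scalar `χθ` (under N3) -/

section ThetaType

variable (L : Type) [Field L] [NumberField L] [IsCMField L] (H : Matrix (Fin 3) (Fin 3) L) {n' : ℕ} (e₁ : Fin 3 × Fin 1 ≃ Fin n')
    (dV : Fin 3 → L) (hdV : ∀ i, IsCMField.complexConj L (dV i) = dV i) (hdV0 : ∀ i, dV i ≠ 0) (g : GL (Fin 3) L)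
    (hg : ((g : Matrix (Fin 3) (Fin 3) L).map (cmConjRingHom L))ᵀ * H * (g : Matrix (Fin 3) (Fin 3) L) = Matrix.diagonal dV)
    (μ : Literature.NumberTheory.Automorphic.IdeleClassGroup L →ₜ* Circle) (hμ : IsConjugateSymplectic L μ)
    (χf : UnitaryGroup.finAdelicOne (↥(maximalRealSubfield L)) L (IsCMField.complexConj L) →* ℂˣ)
    (hcont : Continuous χf) (hunit : ∀ z, ‖((χf z : ℂˣ) : ℂ)‖ = 1)
    (v : HeightOneSpectrum (𝓞 ↥(maximalRealSubfield L)))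

include hcont hunit in
set_option synthInstance.maxHeartbeats 400000 in
set_option maxHeartbeats 16000000 in
/-- **Under N3, the torus acts on the Jacquet module of EVERY representative of a theta-type class by the scalar `χθ`.**  For a non-split `v`, a form
congruence `ᵗT̄ H_v T = a·Φ₃`, a line class `ε`, a centre character `ψθ` (★ `IsThetaCenterChar`) and a class `x₀ ∈ Irr(U(Φ₃)(L⁺_v))` whose transport IS
the theta type (★ `ThetaTypeAtCM`): for every representative `r₀` of `x₀`, `T` acts on `r_N(r₀)` (unnormalised Jacquet module along ★ `cmBorelTriple L 3 v`)
by `t ↦ χθ(t)·id`, `χθ = cmXiTorusChar L v μ_v ψθ⁻¹ ψθ`.  Proof = the transport block of ★ `F0P2oThetaTypeNotL2.thetaType_not_squareIntegrable`: `r₀ ≅ X_v ∘ κ_v⁻¹`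
(★ `nonempty_equiv_of_thetaTypeAtCM`), N3 (b) read along the transported congruence `T′ = g_v⁻¹ T` (★ `formCongr_inv_toLocalGL_mul_eq`), and the injective
Jacquet map of the equivalence. [cite: GelbartRogawski1991, §3.2 (3.2.1)–(3.2.2) p. 457; Lem. 5.1.2 p. 466] [cite: Kudla1986, Thm. 2.8] -/
theorem jacquetModule_eq_smul_of_thetaTypeAtCM
    (hN3 : Literature.NumberTheory.GelbartRogawski1991.thetaType_nonsplit_jacquetModule)
    (hv : ∀ w : PlacesOver L v, IsCMField.complexConj L • w.1 = w.1)
    (T : GL (Fin 3) (UnitaryGroup.LocalRing L v)) (a : UnitaryGroup.LocalRing L v) (ha : IsUnit a)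
    (h : formCongr (conjLocal L (IsCMField.complexConj L) v) T (H.map (algebraMap L (UnitaryGroup.LocalRing L v))) =
      a • (Matrix.of fun i j : Fin 3 => if i.val + j.val + 1 = 3 then (1 : L) else 0).map (algebraMap L (UnitaryGroup.LocalRing L v)))
    (ε : (↥(maximalRealSubfield L))ˣ) (ψθ : ↥(normOneUnits (conjLocal L (IsCMField.complexConj L) v)) →* ℂˣ)
    (hspec : IsThetaCenterChar L μ χf ε v ψθ) (x₀ : IrrClass (Gqs L v))
    (hθ : ThetaTypeAtCM L H e₁ dV hdV hdV0 g hg μ hμ χf ε v (IrrClass.comap (cmDatumLocalCongr L v T ha h).symm x₀))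
    (r₀ : SmoothIrrep (Gqs L v)) (hr₀ : IrrClass.mk r₀ = x₀) :
    ∀ (m : ↥(cmBorelTriple L 3 v).M) (x : ((cmBorelTriple L 3 v).restrict r₀.ρ).Coinvariants),
      r₀.ρ.jacquetModule (cmBorelTriple L 3 v) m x =
        ((cmXiTorusChar L v ((toHeckeCharacter L μ).semilocalComponent L v) ψθ⁻¹ ψθ m : ℂˣ) : ℂ) • x := by
  haveI := locallyCompactSpace_cmBorelU L 3 v
  -- (i) `r₀.ρ ≅ πG`: the representative transported to `U(H)(L⁺_v)`
  obtain ⟨eH⟩ := nonempty_equiv_of_thetaTypeAtCM L H e₁ dV hdV hdV0 g hg μ hμ χf hcont hunit ε v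
    (IrrClass.comap (cmDatumLocalCongr L v T ha h).symm x₀) hθ
    ((r₀.comap (cmDatumLocalCongr L v T ha h).symm).comap (localPiEquiv L (IsCMField.complexConj L) 3 H v))
    (by rw [← hr₀]; rfl)
  -- N3 read along the transported form congruence `T′ = g_v⁻¹ T`
  have h' := F0P2oBorelEigenfunctionalOfJacquetModule.formCongr_inv_toLocalGL_mul_eq L hg v T h
  obtain ⟨-, hTorus⟩ := hN3 L e₁ dV hdV hdV0 (Equiv.prodUnique (Fin 1) (Fin 1)) μ hμ χf hcont hunit v hv ε ψθ hspec
    ((toLocalGL L v g)⁻¹ * T) a ha h'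
  -- a linear isomorphism `E : r₀.V ≃ W` intertwining `r₀.ρ` with `ρ′ = X_v ∘ localPiEquiv⁻¹ ∘ congr_{T′}`
  obtain ⟨E, hE⟩ := exists_linearEquiv_of_comap_comap_equiv (cmDatumLocalCongr L v T ha h).symm
    (localPiEquiv L (IsCMField.complexConj L) 3 H v) r₀ eH
  have hint : ∀ (u : Gqs L v) (x : r₀.V),
      E (r₀.ρ u x) = xThetaGqsCM L e₁ dV hdV hdV0 μ hμ χf ε v ((toLocalGL L v g)⁻¹ * T) ha h' u (E x) := by
    intro u x
    have h1 := hE u x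
    rw [ContinuousMulEquiv.symm_symm] at h1
    have h2 := congrArg (xThetaCM L e₁ dV hdV hdV0 μ hμ χf ε v :
        localPi L (IsCMField.complexConj L) 3 (Matrix.diagonal dV) v →* _)
      (F0P2oBorelEigenfunctionalOfJacquetModule.localCongr_symm_localPiEquiv_symm_cmDatumLocalCongr L hg v T ha h u)
    exact h1.trans (LinearMap.congr_fun h2 _)
  -- the intertwiner `G₀ : r₀.ρ → ρ′` and the injectivity of `r_N(G₀)` (left inverse from `E⁻¹`)
  have hint' : ∀ (u : Gqs L v) (y : _),
      E.symm (xThetaGqsCM L e₁ dV hdV hdV0 μ hμ χf ε v ((toLocalGL L v g)⁻¹ * T) ha h' u y) = r₀.ρ u (E.symm y) := by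
    intro u y
    apply E.injective
    rw [LinearEquiv.apply_symm_apply, hint, LinearEquiv.apply_symm_apply]
  let G₀ : r₀.ρ.IntertwiningMap (xThetaGqsCM L e₁ dV hdV hdV0 μ hμ χf ε v ((toLocalGL L v g)⁻¹ * T) ha h') :=
    (E.toLinearMap).intertwiningMap_of_isIntertwiningMap _ _ (fun u x => hint u x)
  let G₁ : Representation.IntertwiningMap (xThetaGqsCM L e₁ dV hdV hdV0 μ hμ χf ε v ((toLocalGL L v g)⁻¹ * T) ha h') r₀.ρ :=
    (E.symm.toLinearMap).intertwiningMap_of_isIntertwiningMap _ _ (fun u y => hint' u y)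
  have hleft : Function.LeftInverse (Representation.jacquetMap (cmBorelTriple L 3 v) G₁)
      (Representation.jacquetMap (cmBorelTriple L 3 v) G₀) := by
    intro x
    obtain ⟨w, rfl⟩ := Representation.Coinvariants.mk_surjective _ x
    rw [Representation.jacquetMap_mk, Representation.jacquetMap_mk]
    exact congrArg (Representation.Coinvariants.mk _) (E.symm_apply_apply w)
  have hJinj : Function.Injective (Representation.jacquetMap (cmBorelTriple L 3 v) G₀) := hleft.injective
  -- the torus acts on `r_N(r₀.ρ)` by `χθ`
  intro m x
  apply hJinj
  have hJ := Representation.IntertwiningMap.isIntertwining _ _ (Representation.jacquetMap (cmBorelTriple L 3 v) G₀) m x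
  exact hJ.trans ((hTorus m _).trans (map_smul (Representation.jacquetMap (cmBorelTriple L 3 v) G₀) _ x).symm)

end ThetaType

/-! ## §3 `i_G(χ_ξ)` is reducible as soon as a constituent has scalar Jacquet action -/

section CM

variable (L : Type) [Field L] [NumberField L] [IsCMField L] (v : HeightOneSpectrum (𝓞 ↥(maximalRealSubfield L)))

set_option synthInstance.maxHeartbeats 400000 in
set_option maxHeartbeats 16000000 in
/-- **A constituent with SCALAR Jacquet action makes `i_G(χ_ξ)` reducible** (`v` non-split; `χ_ξ = (η̃₁μ‖·‖^{1/2}, η₂)`, spelled ★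
`cmTorusCharPair L v (η₁.comp quotConj · μ · halfModulusChar) η₂` = ★ `cmXiTorusChar L v μ η₁ η₂` by `rfl`; `μ` extends `ω_{E/F}`, all continuous): if a constituent
`x₀ = ⟦r₀⟧` of `i_G(χ_ξ)` has `T` acting on `r_N(r₀)` by scalars `c(t)`, then `i_G(χ_ξ)` has a `G`-stable `⊥ ≠ N ≠ ⊤`.  Otherwise `i_G(χ_ξ)` is irreducible,
`r₀ ≅ i_G(χ_ξ)` (★ `IsConstituentOf.nonempty_equiv_of_isIrreducible`), the normalised Jacquet module `r_B i_G(χ_ξ)` is scalar too (`δ_B^{-1/2}(t)c(t)`), while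
★ N1 (p832625) gives a `wχ_ξ`-line with quotient `χ_ξ` and ★ R1 `χ_ξ ≠ wχ_ξ` — contradicting §1.
[cite: Casselman1995, L. 7.1.1 (a) p. 67; Prop. 6.4.1 p. 62] [cite: Rogawski1990, §12.2 (2) pp. 173–174] -/
theorem cmPrincipalSeries_xi_reducible_of_constituent_jacquet_smul
    (hns : ∀ w : PlacesOver L v, IsCMField.complexConj L • w.1 = w.1)
    (μ : (LocalRing L v)ˣ →* ℂˣ) (η₁ η₂ : ↥(normOneUnits (conjLocal L (IsCMField.complexConj L) v)) →* ℂˣ)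
    (hμ : IsQuadraticCharExtension (conjLocal L (IsCMField.complexConj L) v) μ)
    (hμc : Continuous fun x => ((μ x : ℂˣ) : ℂ)) (h1c : Continuous fun x => ((η₁ x : ℂˣ) : ℂ)) (h2c : Continuous fun x => ((η₂ x : ℂˣ) : ℂ))
    (x₀ : IrrClass (Gqs L v))
    (hconst : x₀.IsConstituentOf (cmPrincipalSeries L 3 v (cmTorusCharPair L v
      (η₁.comp (quotConj (conjLocal L (IsCMField.complexConj L) v) (conjLocal_conjLocal_cm L v)) * μ * halfModulusChar (LocalRing L v)) η₂)))
    (r₀ : SmoothIrrep (Gqs L v)) (hr₀ : IrrClass.mk r₀ = x₀) (c : ↥(cmBorelTriple L 3 v).M → ℂ)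
    (hM : ∀ (m : ↥(cmBorelTriple L 3 v).M) (x : ((cmBorelTriple L 3 v).restrict r₀.ρ).Coinvariants),
      r₀.ρ.jacquetModule (cmBorelTriple L 3 v) m x = c m • x) :
    ∃ N : Subrepresentation (cmPrincipalSeries L 3 v (cmTorusCharPair L v
      (η₁.comp (quotConj (conjLocal L (IsCMField.complexConj L) v) (conjLocal_conjLocal_cm L v)) * μ * halfModulusChar (LocalRing L v)) η₂)),
      N ≠ ⊥ ∧ N ≠ ⊤ := by
  haveI := locallyCompactSpace_cmBorelU L 3 v
  -- N1 at `χ_ξ` through its theorem-world bridge; one generic call (§1b) with R1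
  obtain ⟨hfd, hX2, ℓ, hℓ1, hline, hquot⟩ := (UnitaryGroup.U3PrincipalSeriesJacquetFiltration_iff L).1
    (F0P3U3PrincipalSeriesJacquetFiltrationHolds.U3PrincipalSeriesJacquetFiltration_holds L) v hns _ η₂
    (continuous_cmXiTorusChar_fst L v μ η₁ hμc h1c) h2c
  have hc' := hr₀ ▸ hconst
  exact exists_subrepresentation_of_constituent_jacquet_smul hfd hX2 ℓ hℓ1 hline hquot
    (F0P3KeysLabelledPair.cmWeylTorusCharPair_ne_cmXiTorusChar L v μ η₁ η₂ hμ) r₀ hc' c hM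

/-! ## §4 Keys' case-two reducibility at the programme's global data, from the letter #96 (N3) -/

set_option synthInstance.maxHeartbeats 400000 in
set_option maxHeartbeats 16000000 in
/-- **N4 AT THE GLOBAL DATA `(μω, ξ)` FROM N3 (#96).**  For a CM field `L`, a one-dimensional `ξ = (η, ψ)` (★ `OneDimAutRepH`), Rogawski's unitary `μω` with
`μω|_{𝕀_{L⁺}} = ω_{L/L⁺}` (the closer's `hquad`), and a finite place `v` of `L⁺` NOT split in `L`: the principal series `i_G(χ_ξ,v)` of `G = U(Φ₃)(L⁺_v)`,
`χ_ξ,v = cmXiTorusChar L v μω_v ξ.η_v ξ.ψ_v` (EXACTLY the instance ★ `F0P3XiPacketFamilyOfRecordGlue.keysOfKeysCaseTwo` consumes), has a `G`-stable subspace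
`⊥ ≠ N ≠ ⊤` — conditionally on the ONE print letter `hN3` [GelbartRogawski1991 §3.2; Kudla1986 Thm. 2.8].  Assembly: the U′-N letter from {N3, K1w ★ p833012, U1 ★ ⟸
N3 + N1 ★} (★ `GR91N_of_letters`) at the dictionary witness `(grdMu, grdChi)` ★ and the rational frame of `Φ₃` ★ (`T = 1`, `a = 1`) gives a theta-type constituent
`x₀`; a centre character exists at every line (★ `exists_forall_isThetaCenterChar`); §2 makes its Jacquet action scalar; §3 concludes (local `IsQuadraticCharExtension`
from `hquad` ★, continuity of the components ★).  NOT the local-universal ★ `KeysCaseTwoReducible L` (that needs every local triple to be globalisable).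
[cite: GelbartRogawski1991, §5.1 (5.1.1) p. 465, Lem. 5.1.2 pp. 465–466; §3.2 p. 457] [cite: Rogawski1990, §12.2 (2) pp. 173–174] [cite: Keys1984, §7 Thm. (2) p. 126] -/
theorem keysCaseTwoReducibleAt_of_N3 (hN3 : Literature.NumberTheory.GelbartRogawski1991.thetaType_nonsplit_jacquetModule)
    (ξ : OneDimAutRepH L) (μω : HeckeCharacter L) (hμu : μω.IsUnitary)
    (hquad : ∀ x : Literature.NumberTheory.GaloisRepresentations.ideleGroup ↥(maximalRealSubfield L),
      μω (AdeleRing.ideleBaseChange (↥(maximalRealSubfield L)) L x) = quadraticHeckeCharCM L x)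
    (hv : ∀ w : PlacesOver L v, IsCMField.complexConj L • w.1 = w.1) :
    ∃ N : Subrepresentation (cmPrincipalSeries L 3 v (cmXiTorusChar L v (μω.semilocalComponent L v)
      (torusLocalComponent L (IsCMField.complexConj L) v ξ.η) (torusLocalComponent L (IsCMField.complexConj L) v ξ.ψ))), N ≠ ⊥ ∧ N ≠ ⊤ := by
  -- the letters behind U′-N: N3 = `hN3`; K1w ★; U1 ⟸ N3 + (unique sub ⟸ N1 ★)
  have hW : cmPrincipalSeries_isConstituentOf_weylConj := F0P2pK1wHolds.cmPrincipalSeries_isConstituentOf_weylConj_holds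
  have hU1 : u1ThetaDichotomy_nonsplit := F0P2oU1LetterOfTower.u1ThetaDichotomy_nonsplit_of_uniqueSub hN3
    (F0P2pPrincipalSeriesUniqueSubCM.principalSeries_uniqueSub
      fun L _ _ _ => F0P3U3PrincipalSeriesJacquetFiltrationHolds.U3PrincipalSeriesJacquetFiltration_holds L)
  have hGR := F0P2oGR91NOfLetters.GR91N_of_letters hN3 hW hU1
  -- the rational frame of `Φ₃` and the trivial form congruence at `v`
  obtain ⟨dV₀, S, hdV₀, hdV₀0, hS⟩ := F0P3bXiLocalPacketUnitaryOfStubs.exists_qsFrame L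
  have hcong : formCongr (conjLocal L (IsCMField.complexConj L) v) (1 : GL (Fin 3) (UnitaryGroup.LocalRing L v))
      ((qsForm L).map (algebraMap L (UnitaryGroup.LocalRing L v))) =
      (1 : UnitaryGroup.LocalRing L v) • (Matrix.of fun i j : Fin 3 => if i.val + j.val + 1 = 3 then (1 : L) else 0).map
        (algebraMap L (UnitaryGroup.LocalRing L v)) := by
    rw [formCongr_one_eq, one_smul]
  -- the theta-type constituent of `i_G(χ_ξ)` (U′-N at the dictionary witness)
  obtain ⟨x₀, hconst, ε, hθ⟩ := hGR.nonsplit L (qsForm L) (antidiagOne_isHermitian L 3) (isUnit_antidiagOne_det L 3)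
    (Equiv.prodUnique (Fin 3) (Fin 1)) dV₀ hdV₀ hdV₀0 S hS ξ μω hμu hquad (grdMu L ξ μω hμu) (isConjugateSymplectic_grdMu L ξ μω hμu hquad)
    (grdChi L ξ μω hquad) (continuous_grdChi L ξ μω hquad) (norm_grdChi_apply L ξ hμu hquad) (semilocalComponent_toHeckeCharacter_grdMu L ξ μω hμu)
    (fun z => grdChi_finAdelicCheck L ξ μω hquad _ z) v hv 1 1 isUnit_one hcong
  -- a centre character at every line, and a representative
  obtain ⟨ψθ, hψθ⟩ := F0P2oK1aWOfLetters.exists_forall_isThetaCenterChar L (grdMu L ξ μω hμu) (grdChi L ξ μω hquad) v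
  obtain ⟨r₀, hr₀⟩ := IrrClass.mk_surjective x₀
  -- §2: scalar Jacquet action on `r₀`
  have hM := jacquetModule_eq_smul_of_thetaTypeAtCM L (qsForm L) (Equiv.prodUnique (Fin 3) (Fin 1)) dV₀ hdV₀ hdV₀0 S hS
    (grdMu L ξ μω hμu) (isConjugateSymplectic_grdMu L ξ μω hμu hquad) (grdChi L ξ μω hquad) (continuous_grdChi L ξ μω hquad)
    (norm_grdChi_apply L ξ hμu hquad) v hN3 hv 1 1 isUnit_one hcong ε ψθ (hψθ ε) x₀ hθ r₀ hr₀
  -- §3 at `χ_ξ` (★ `cmXiTorusChar_eq_cmTorusCharPair` is `rfl`)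
  exact cmPrincipalSeries_xi_reducible_of_constituent_jacquet_smul L v hv (μω.semilocalComponent L v)
    (torusLocalComponent L (IsCMField.complexConj L) v ξ.η) (torusLocalComponent L (IsCMField.complexConj L) v ξ.ψ)
    (isQuadraticCharExtension_semilocalComponent_of_baseChange_eq μω hquad v)
    (Units.continuous_val.comp (continuous_semilocalComponent L μω))
    (continuous_torusLocalComponent L (IsCMField.complexConj L) ξ.η) (continuous_torusLocalComponent L (IsCMField.complexConj L) ξ.ψ)
    x₀ hconst r₀ hr₀ _ hM

end CM

end Summit.HodgeConjecture.HodgeConjecture.Cruxes.H413.F0P3KeysReducibleAtXiDataOfN3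

end
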